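import Summits.CriticalPhenomena.PercolationContinuityZ3.Theorems.PercNearOneGluingNoHeavyLowerTailQuantitativeK6HarrisFloor
import Summits.CriticalPhenomena.PercolationContinuityZ3.Theorems.PercNearOneGluingNoHeavyLowerTailQuantitativeBHKOffCluster
import HarnessLib

/-!
# The set four-point transfer (K6) with BOTH discarded terms floored: Harris term + Glauber floor of the two-set repulsion

Support file (`--supports stmt-CriticalPhenomena-4575`), prover seat `prim-rate-mine-2` (lane prim-rate, constants-miner (c), BENCH rows
M2-R5 / M2-R12, relay-SET form; `run/shared/lean/prim/prim-rate/prim-rate-mine-2/CANDIDATES.md` §gen-3).  No definitions, no named facts,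
no sorries; standard axioms.

The tree's (K6) `CSH.covTransfer_relaySet_edge` (paper Lemma 3.8 — the level-0 step of the conditioned slack hierarchy, for a relay SET `S`,
`x ∈ S`, a monotone edge-cluster functional `g`, observers `o, v`) is «Harris on `U = {o↔S} ∪ {o↔v}`» + «van den Berg–Häggström–Kahn
repulsion of `g(𝒞_x)` and `1{o↔v}` given `v ↮ S`», and discards BOTH nonnegative terms.  Gen 1 restored the Harris term
(`CSH.covTransfer_relaySet_edge_harrisFloor`, p307130); gen 2/3 floored the repulsion for `S = {x}`, `g = 1{x↔b}` (`QuantBHK.level0Margin_*`).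
THIS FILE restores both for every relay set and every monotone `g`:

  `μ(D∩{o↔v})·(∫_{v↔S} g − μ(v↔S)·m) + μ(D)·(∫_U g − μ(U)·m) + μ(D)·𝒲_e ≤ μ(D)·(∫_{o↔S} g − μ(o↔S)·m)`,   `D = {v ↮ S}`, `m = ∫ g(𝒞_x)`,

with, for ANY pair `e`, the Glauber floor of the lane's quantitative BHK Thm 1.4 (off-cluster form, `QuantBHK.offCluster_negCov_ge_glauberTerm`)
`𝒲_e = w_e(1−w_e)·∫ 1_D(ω∪e)·(1{o ∈ C_v(ω∪e)} − 1{o ∈ C_v(ω∖e)})·(Ψ(C_v(ω∖e)) − Ψ(C_v(ω∪e))) dμ ≥ 0`, `Ψ(W) = ∫ g(𝒞_x(η ∖ A(W))) dμ(η)`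
(`A(W)` = the pairs meeting `W`): «the pair `e` is pivotal for `o ↔ v` while `v ↮ S` survives, times the drop of the conditional mean of
`g(𝒞_x)` when `C_v` absorbs the new vertices» — `CSH.covTransfer_relaySet_edge_harris_add_glauberFloor`.  The level-0 brick of every CSH /
(S5) margin with both of its discarded terms made explicit (the H-part integrates this over the worlds of the avoided cluster).
[cite: VandenbergHaggstromKahn2005, Thm. 1.3 (p. 6), Thm. 1.4 (p. 7) with Remark 1 after Thm. 1.2 (p. 5), display (10) (p. 7)]
[cite: Harris1960, Lemma 4.1 (p. 16)]
-/

noncomputable section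

namespace Summit.CriticalPhenomena.PercolationContinuityZ3.Theorems

open MeasureTheory Set Literature.Probability.LatticeModels Literature.Probability.Percolation
open Literature.Probability.Percolation.BHK2006 (openEdgeCluster_mono openEdgeCluster_eq_sdiff_bar)
open scoped Classical
open KNPreFKG

namespace CSH

variable {V : Type*} [Fintype V]

omit [Fintype V] in
/-- On `{v ↮ x}` the open edge cluster of `x` does not see the pairs meeting `C_v`: deleting them changes nothing
(BHK's domain Markov property, configuration level). [cite: VandenbergHaggstromKahn2005, §1 p. 8] -/
theorem openEdgeCluster_sdiff_meeting_eq {ω : BondConfig V} {v x : V} (hvx : ¬ (openGraph ω).Reachable v x) :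
    openEdgeCluster (ω \ {f | ∃ u ∈ openCluster ω v, u ∈ f}) x = openEdgeCluster ω x := by
  have hbar : {f : Sym2 V | ∃ u ∈ openCluster ω v, u ∈ f} = {e | ∃ u ∈ e, u = v ∨ ∃ e' ∈ openEdgeCluster ω v, u ∈ e'} := by
    ext f
    simp only [Set.mem_setOf_eq, openCluster_eq_setOf_openEdgeCluster]
    constructor
    · rintro ⟨u, hu, huf⟩; exact ⟨u, huf, hu⟩
    · rintro ⟨u, huf, hu⟩; exact ⟨u, hu, huf⟩
  have hx : ¬ (x = v ∨ ∃ e ∈ openEdgeCluster ω v, x ∈ e) := by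
    intro h
    have h' : x ∈ openCluster ω v := by
      rw [openCluster_eq_setOf_openEdgeCluster]; exact h
    exact hvx h'
  rw [hbar]
  exact (openEdgeCluster_eq_sdiff_bar rfl hx).symm

/-- **(K6) for a relay set with the Harris term kept AND the repulsion floored (Glauber member).**  For `x ∈ S`, `g` monotone on edge sets,
`m = ∫ g(𝒞_x)`, `D = {v ↮ S}`, `U = {o ↔ S} ∪ {o ↔ v}`, `Ψ(W) = ∫ g(𝒞_x(η ∖ A(W))) dμ(η)` and any pair `e`:
  `μ(D ∩ {o↔v})·(∫_{v↔S} g(𝒞_x) − μ(v↔S)·m) + μ(D)·(∫_U g(𝒞_x) − μ(U)·m)`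
  `+ μ(D)·w_e(1−w_e)·∫ 1_D(ω∪e)·(1{o ∈ C_v(ω∪e)} − 1{o ∈ C_v(ω∖e)})·(Ψ(C_v(ω∖e)) − Ψ(C_v(ω∪e))) dμ ≤ μ(D)·(∫_{o↔S} g(𝒞_x) − μ(o↔S)·m)`.
The level-0 CSH margin for a relay SET with both discarded terms explicit (BENCH rows M2-R5/M2-R12, set form; prim-rate lane).  Proof: the
bookkeeping of `covTransfer_relaySet_edge_harrisFloor` with vdBHK's sign statement replaced by `QuantBHK.offCluster_negCov_ge_glauberTerm`
(`s = v`, `X = S`, `F = 1{o ∈ ·}`, `K = g ∘ 𝒞_x`; on `D`, `K(ω ∖ A(C_v)) = g(𝒞_x(ω))` by `openEdgeCluster_sdiff_meeting_eq`).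
[cite: VandenbergHaggstromKahn2005, Thm. 1.3 (p. 6), Thm. 1.4 (p. 7), display (10) (p. 7)] [cite: Harris1960, Lemma 4.1 (p. 16)] -/
theorem covTransfer_relaySet_edge_harris_add_glauberFloor (w : Sym2 V → unitInterval) (S : Finset V) (o v x : V) (hxS : x ∈ S)
    (g : Set (Sym2 V) → ℝ) (hg : Monotone g) (e : Sym2 V) :
    (prodBernoulli w).real ({ω : BondConfig V | ∀ t ∈ S, ¬ (openGraph ω).Reachable v t} ∩ openConn o v) *
          (∫ ω in (⋃ t ∈ S, openConn v t), g (openEdgeCluster ω x) ∂(prodBernoulli w) -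
            (prodBernoulli w).real (⋃ t ∈ S, openConn v t) * ∫ ω, g (openEdgeCluster ω x) ∂(prodBernoulli w)) +
        (prodBernoulli w).real {ω : BondConfig V | ∀ t ∈ S, ¬ (openGraph ω).Reachable v t} *
          (∫ ω in ((⋃ t ∈ S, openConn o t) ∪ openConn o v), g (openEdgeCluster ω x) ∂(prodBernoulli w) -
            (prodBernoulli w).real ((⋃ t ∈ S, openConn o t) ∪ openConn o v) * ∫ ω, g (openEdgeCluster ω x) ∂(prodBernoulli w)) +
        (prodBernoulli w).real {ω : BondConfig V | ∀ t ∈ S, ¬ (openGraph ω).Reachable v t} *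
          ((w e : ℝ) * (1 - w e) *
            ∫ ω, ({ω : BondConfig V | ∀ t ∈ S, ¬ (openGraph ω).Reachable v t}).indicator (fun _ => (1 : ℝ)) (insert e ω) *
              (((if o ∈ openCluster (insert e ω) v then (1 : ℝ) else 0) - (if o ∈ openCluster (ω \ {e}) v then (1 : ℝ) else 0)) *
                ((∫ η, g (openEdgeCluster (η \ {f | ∃ u ∈ openCluster (ω \ {e}) v, u ∈ f}) x) ∂(prodBernoulli w)) -
                  (∫ η, g (openEdgeCluster (η \ {f | ∃ u ∈ openCluster (insert e ω) v, u ∈ f}) x) ∂(prodBernoulli w))))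
              ∂(prodBernoulli w)) ≤
      (prodBernoulli w).real {ω : BondConfig V | ∀ t ∈ S, ¬ (openGraph ω).Reachable v t} *
        (∫ ω in (⋃ t ∈ S, openConn o t), g (openEdgeCluster ω x) ∂(prodBernoulli w) -
          (prodBernoulli w).real (⋃ t ∈ S, openConn o t) * ∫ ω, g (openEdgeCluster ω x) ∂(prodBernoulli w)) := by
  set μ := prodBernoulli w with hμ
  set f : BondConfig V → ℝ := fun ω => g (openEdgeCluster ω x) with hf
  set m : ℝ := ∫ ω, f ω ∂μ with hm
  have hmeas : ∀ T : Set (BondConfig V), MeasurableSet T := fun _ => MeasurableSet.of_discrete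
  have hint : ∀ (k : BondConfig V → ℝ) (T : Set (BondConfig V)), IntegrableOn k T μ :=
    fun k T => (Integrable.of_finite).integrableOn
  have hn := fun (T : Set (BondConfig V)) => (measureReal_nonneg : 0 ≤ μ.real T)
  set D : Set (BondConfig V) := {ω | ∀ t ∈ S, ¬ (openGraph ω).Reachable v t} with hD
  set OT : Set (BondConfig V) := ⋃ t ∈ S, openConn o t with hOT
  set Ov : Set (BondConfig V) := openConn o v with hOv
  set Q : Set (BondConfig V) := ⋃ t ∈ S, openConn v t with hQ
  set U : Set (BondConfig V) := OT ∪ Ov with hU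
  -- the floored repulsion: quantitative BHK 1.4, off-cluster form, for `F = 1{o ∈ C_v}` and `K = g ∘ 𝒞_x` given `v ↮ S`
  set F : Set V → ℝ := fun W => if o ∈ W then 1 else 0 with hF
  set K : Set (Sym2 V) → ℝ := fun η => g (openEdgeCluster η x) with hK
  have hFmono : Monotone F := by
    intro W W' h
    simp only [hF]
    by_cases ho : o ∈ W
    · rw [if_pos ho, if_pos (h ho)]
    · rw [if_neg ho]; split_ifs <;> norm_num
  have hKmono : Monotone K := fun η η' h => hg (openEdgeCluster_mono h x)
  have hOff := QuantBHK.offCluster_negCov_ge_glauberTerm w v (↑S : Set V) e F K hFmono hKmono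
  have hDset : {ω : BondConfig V | ∀ t ∈ (↑S : Set V), ¬ (openGraph ω).Reachable v t} = D := by
    ext ω; simp [hD]
  rw [hDset, ← hμ] at hOff
  -- identify the three `D`-integrals
  have hFind : (fun ω : BondConfig V => F (openCluster ω v)) = Ov.indicator fun _ => (1 : ℝ) := by
    funext ω
    simp only [hF, hOv, Set.indicator_apply]
    rw [openConn_symm o v]
    rfl
  have hIF : ∫ ω in D, F (openCluster ω v) ∂μ = μ.real (D ∩ Ov) := by
    rw [hFind, integral_indicator (hmeas _), Measure.restrict_restrict (hmeas _), integral_const, smul_eq_mul, mul_one,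
      measureReal_restrict_apply_univ, Set.inter_comm]
  have hKD : ∀ ω ∈ D, K (ω \ {f' | ∃ u ∈ openCluster ω v, u ∈ f'}) = f ω := by
    intro ω hω
    simp only [hK, hf]
    rw [openEdgeCluster_sdiff_meeting_eq (hω x hxS)]
  have hIK : ∫ ω in D, K (ω \ {f' | ∃ u ∈ openCluster ω v, u ∈ f'}) ∂μ = ∫ ω in D, f ω ∂μ :=
    setIntegral_congr_fun (hmeas D) hKD
  have hIFK : ∫ ω in D, F (openCluster ω v) * K (ω \ {f' | ∃ u ∈ openCluster ω v, u ∈ f'}) ∂μ = ∫ ω in D ∩ Ov, f ω ∂μ := by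
    have h1 : ∫ ω in D, F (openCluster ω v) * K (ω \ {f' | ∃ u ∈ openCluster ω v, u ∈ f'}) ∂μ =
        ∫ ω in D, Ov.indicator (fun _ => (1 : ℝ)) ω * f ω ∂μ := by
      refine setIntegral_congr_fun (hmeas D) fun ω hω => ?_
      rw [hKD ω hω, ← hFind]
    rw [h1, ← setIntegral_mul_indicator_one μ D Ov f]
    refine setIntegral_congr_fun (hmeas D) fun ω _ => ?_
    by_cases h : ω ∈ Ov
    · simp [Set.indicator_of_mem h]
    · simp [Set.indicator_of_notMem h]
  rw [hIF, hIK, hIFK] at hOff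
  -- `U = OT ⊔ (D ∩ Ov)`
  have hUdiff : U \ OT = D ∩ Ov := by
    ext ω
    simp only [hU, hOT, hOv, hD, mem_sdiff, mem_union, mem_iUnion, mem_inter_iff, exists_prop, not_exists, not_and, openConn,
      mem_setOf_eq]
    constructor
    · rintro ⟨h | h, hno⟩
      · obtain ⟨t, ht, h'⟩ := h; exact absurd h' (hno t ht)
      · exact ⟨fun t ht hvt => hno t ht (h.trans hvt), h⟩
    · rintro ⟨hd, hov⟩
      exact ⟨Or.inr hov, fun t ht hot => hd t ht (hov.symm.trans hot)⟩
  have hUint : ∫ ω in U, f ω ∂μ = ∫ ω in OT, f ω ∂μ + ∫ ω in D ∩ Ov, f ω ∂μ := by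
    rw [← integral_inter_add_sdiff (hmeas OT) (hint f U), inter_eq_right.2 subset_union_left, hUdiff]
  have hUμ : μ.real U = μ.real OT + μ.real (D ∩ Ov) := by
    rw [← measureReal_inter_add_sdiff (s := U) (h := measure_ne_top _ _) (hmeas OT), inter_eq_right.2 subset_union_left, hUdiff]
  -- `D = Qᶜ`
  have hDQ : D = Qᶜ := by
    ext ω
    simp [hD, hQ, openConn]
  have hDint : ∫ ω in D, f ω ∂μ = m - ∫ ω in Q, f ω ∂μ := by
    have := integral_add_compl (hmeas Q) (Integrable.of_finite (f := f) (μ := μ))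
    rw [← hDQ] at this
    linarith
  have hDμ : μ.real D = 1 - μ.real Q := by
    have h1 : μ.real (univ : Set (BondConfig V)) = μ.real (univ ∩ Q) + μ.real (univ \ Q) :=
      (measureReal_inter_add_sdiff (s := univ) (h := measure_ne_top _ _) (hmeas Q)).symm
    rw [probReal_univ, univ_inter, ← compl_eq_univ_sdiff, ← hDQ] at h1
    linarith
  -- assemble: exact bookkeeping + the single floored inequality `hOff`
  rw [hDint] at hOff
  rw [hUint, hUμ, hDμ]
  rw [hDμ] at hOff
  nlinarith [hOff, hn (D ∩ Ov), hn Q]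

end CSH

end Summit.CriticalPhenomena.PercolationContinuityZ3.Theorems
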